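import Summits.BirchSwinnertonDyer.BirchSwinnertonDyer.Theorems.KimAtThreeDeepLowerOffStratumLevelLoweringRibetRowsCE
import HarnessLib

/-!
# Route `KimAtThreeKolyvagin` (rung W2), crux `DeepLowerAtThreeOffKatoStratum` (item 19679), registered
# stub `stub_nonAdditive`, ROAD (b): the semistable depth-`1` rows from the BARE EXISTENCE of a level-lowered
# newform — every prime `q` INCLUDING `q = 3` (socket for the `q = 3` twin of the (R1) fact, cite item wi-76751)

Cell `bsd-addord`, seat `bsd-addord-w2-acc2` (PROGRAMME PART 1b, ACCEL-LIST row (2)), gen 5; item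
`stmt-BirchSwinnertonDyer-19679` (OWNER w2-c2 assembles; `--supports`, closes nothing). Planner ROW CENSUS (STATUS
ROUTING 2026-08-27T03:35:16Z, `planner/r1census/`): of the 29 656 optimal semistable `r = 0` tower rows with
`v₃(∏ c_ℓ) = 1`, the landed (R1) fact `ribet1990_levelLowering_gamma0_newform_at_three` (`q ≠ 3`) covers 15 624; the
`q = 3` bucket (the Tamagawa-`3` prime IS `3`: split multiplicative at `3` with `3 ∣ ord_3 Δ`, `ρ̄` finite at `3`)
holds 7 294 rows, 5 054 of which meet (F1), and waits on the (R1) TWIN at `q = 3` (cite item wi-76751: Ribet 1990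
Thm. 1.1 case `ℓ = p` + Diamond 1995 Thm. 6.4 with `k(ρ̄) = 2`, `a_3(g) ≡ 1`). THIS FILE makes the rest of
ROAD (b) independent of WHICH level-lowering fact supplies the newform: its hypothesis is the bare conclusion shape
«for the chosen `ι : ℚ̄₃ ≃ ℂ` there is a newform `g ∈ S₂(Γ₀(M))` with `a_ℓ(g) ≡ a_ℓ(D₀.f)` for every prime `ℓ ≠ q`
and `a_q(g) ≡ q + 1`», for ANY prime `q` with `q ∤ M`, `M` squarefree — `q = 3` included (there `a_3(g) ≡ 4 ≡ 1`,
the root `β ≡ 3 ≡ 0`, `α ≡ 1`: `α ≠ β` for free; Vatsal's congruence is the Greenberg–Vatsal multiplicative-at-`3`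
variant, already wired in gen 4's `isStabilisedLevelLoweringCongruenceIn_three_of_not_addv`; Ihara's lemma
`ribet1984_iharaLemma` allows `p = ℓ = 3`).

★★★ `stub_nonAdditive_semistable_depthOne_of_exists_levelLoweredNewform` — stub binders VERBATIM (level `M·q`) +
`Semistable W₀` + «ordinary if good at `3`» + `v₃(∏ c_ℓ) ≤ 1` + `q` split multiplicative, `q ∤ M`, `M` squarefree +
the EXISTENCE of the congruent level-`M` newform (for every `ι`) ⟹ the LOWER deep inequality of 19679, from ELEVEN
NAMED FACTS (`colemanEdixhoven1998_heckePolynomial_simpleRoots` is used only when `q ≡ 1 (mod 3)`). Consequences: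
(i) `…RibetRowsFinal`/`…RibetRowsCE` are the case `q ≠ 3` fed by the landed fact; (ii) the `q = 3` bucket closes
the moment wi-76751 lands, by ONE application. Theorems only; nothing booked; BSD is not proved by any of this.
-/

set_option autoImplicit false
-- the Theorems namespace of a single-conjunct summit repeats the summit name by design (D-0017)
set_option linter.dupNamespace false

noncomputable section

open scoped MatrixGroups ModularForm Classical NNReal

open CongruenceSubgroup WeierstrassCurve Literature.NumberTheory.EllipticCurves
  Literature.NumberTheory.EllipticCurves.ModularForms

namespace Summit.BirchSwinnertonDyer.BirchSwinnertonDyer.Theorems.KimAtThreeDeepLowerOffStratumLevelLoweringRibetRowsOfExists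

open Summit.BirchSwinnertonDyer.BirchSwinnertonDyer.Theorems.KimAtThreeDeepLowerOffStratumLevelLoweringVatsal
open Summit.BirchSwinnertonDyer.BirchSwinnertonDyer.Theorems.KimAtThreeDeepLowerOffStratumLevelLoweringVatsalStabRows
open Summit.BirchSwinnertonDyer.BirchSwinnertonDyer.Theorems.KimAtThreeDeepLowerOffStratumLevelLoweringVatsalIharaRows
open Summit.BirchSwinnertonDyer.BirchSwinnertonDyer.Theorems.KimAtThreeDeepLowerOffStratumLevelLoweringConditionOne
open Summit.BirchSwinnertonDyer.BirchSwinnertonDyer.Theorems.KimAtThreeDeepLowerOffStratumLevelLoweringCanonicalPeriod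
open Summit.BirchSwinnertonDyer.BirchSwinnertonDyer.Theorems.KimAtThreeDeepLowerOffStratumLevelLoweringRibetRows
open Summit.BirchSwinnertonDyer.BirchSwinnertonDyer.Theorems.KimAtThreeDeepLowerOffStratumLevelLoweringNonEisensteinPrime
open Literature.NumberTheory.EllipticCurves.Rank1Residual Literature.NumberTheory.EllipticCurves.Rank1Residual.Typed
  Literature.NumberTheory.EllipticCurves.Skinner2016 Literature.NumberTheory.Automorphic

/-- ★★★ **`stub_nonAdditive` (crux 19679) on its SEMISTABLE depth-`1` rows from the BARE EXISTENCE of a congruent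
level-`M` newform, for EVERY prime `q` (including `q = 3`) with `q ∤ M`, `M` squarefree.** Binders: eleven named
facts (`hCE` is used only when `q ≡ 1 (mod 3)`); the registered stub's binders VERBATIM (level `M·q`);
`Semistable W₀`; «ordinary if good at `3`»; `v₃(∏ c_ℓ) ≤ 1`; `q` split multiplicative, `q ∤ M`, `M` squarefree; and
`hex`: for every `ι : ℚ̄₃ ≃ ℂ` a newform `g ∈ S₂(Γ₀(M))` with `a_ℓ(g) ≡ a_ℓ(D₀.f)` (`ℓ ≠ q` prime), `a_q(g) ≡ q + 1` —
the conclusion shape of `ribet1990_levelLowering_gamma0_newform_at_three` and of its `q = 3` twin (wi-76751).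
Inside: the root `β ≡ q` (`exists_root_valuation_sub_lt_one`), `α ≠ β` (free for `q ≢ 1 (mod 3)`, else
Coleman–Edixhoven `.root_ne`), Condition 1 ×2 (`…ConditionOne`), the numeral `r₀ ≡ 1 (mod Mq)` by Chebotarev
(`exists_prime_one_mod_not_dvd_frobeniusTrace_sub`), the canonical period (`exists_period_integral_unit_cycle`), then
gen 4's `stub_nonAdditive_semistable_of_vatsal_of_ihara`. [cite: Vatsal1999, §1 (1.6), Thm. (1.13)]
[cite: GreenbergVatsal2000, §3 (17)–(19)] [cite: Ribet1984ICM, Thm. 4.1] [cite: ColemanEdixhoven1998, Thm. 2.1]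
[cite: TateGCFT1967, §2.4 (Tchebotarev density theorem) with Prop. 2.3] [cite: Skinner2016PacificMC, Thm. C (§1)]
[cite: Mazur1978, Cor. 4.1] [cite: Kim2022StructureSelmer, Conj. 1.10 (PDF p. 8)] -/
theorem stub_nonAdditive_semistable_depthOne_of_exists_levelLoweredNewform
    (hCE : colemanEdixhoven1998_heckePolynomial_simpleRoots)
    (hV : vatsal1999_plusSymbol_congruence) (hGV : greenbergVatsal2000_plusSymbol_congruence)
    (hI : ribet1984_iharaLemma)
    (hSk : Skinner2016.thmC_padicValRat_bsd_rank_zero)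
    (hmod : hasEntireLFunction_rat) (hGZK : rank_eq_analyticRank_of_analyticRank_le_one)
    (hM : mazur_not_dvd_maninConstant_of_odd)
    (hBCDT : exists_isNewformOf) (hLL' : diamond1995_refinedSerre) :
    ∀ (W₀ : WeierstrassCurve ℚ) [W₀.IsElliptic] [W₀.IsGloballyMinimal],
      (∀ n : ℕ, W₀.HasSurjectiveModNGaloisRep (3 ^ n : ℕ)) → Finite W₀.sha →
      ∀ {M q : ℕ} [NeZero M] [NeZero q] [Fact q.Prime] [NeZero (M * q)], M * q = W₀.conductorNorm ℤ →
      ∀ (D₀ : ModularParametrizationData W₀ (M * q)),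
        (∀ z ∈ D₀.L.lattice, ∃ w ∈ periodLattice D₀.f, z = D₀.c * w) →
        (∀ (W₂ : WeierstrassCurve ℚ) [W₂.IsElliptic] (D₂ : ModularParametrizationData W₂ (M * q)),
          D₂.f = D₀.f → D₀.modularDegree ≤ D₂.modularDegree) →
        (∀ r : ℚ, ratPlusSymbol D₀.f r ≠ 0 → 0 ≤ padicValRat 3 (ratPlusSymbol D₀.f r)) →
        kuriharaVanishingOrder W₀ 3 D₀.f = 0 →
        ¬ (haveI : Fact (Nat.Prime 3) := ⟨Nat.prime_three⟩; Addv W₀ 3) →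
        Semistable W₀ →
        (W₀.HasGoodReductionAtPrime 3 → ¬ (3 : ℤ) ∣ W₀.frobeniusTrace 3) →
        padicValNat 3 W₀.tamagawaProduct ≤ 1 →
        W₀.HasSplitMultiplicativeReductionAtPrime q → ¬ q ∣ M → Squarefree M →
        (∀ ι : PadicAlgCl 3 ≃+* ℂ, ∃ g : CuspForm (Gamma0 M) 2, IsNewform0 g ∧
          (∀ ℓ : ℕ, ℓ.Prime → ℓ ≠ q → Valued.v (ι.symm (cuspCoeff D₀.f ℓ - cuspCoeff g ℓ)) < 1) ∧
          Valued.v (ι.symm (cuspCoeff g q - (q + 1))) < 1) →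
        ∃ d : ℕ, kuriharaPartialDeepInfty W₀ 3 D₀.f = d ∧
          kuriharaPartial W₀ 3 D₀.f 0 ≤
            ((padicValNat 3 (Nat.card (AddCommGroup.primaryComponent W₀.sha 3)) + d : ℕ) : ℕ∞) := by
  intro W₀ _ _ htower hfin M q _ _ _ _ hN D₀ hopt hdeg hint hord hnA hsst hordinary hv hsplit hqM hMsq hex
  have hq : q.Prime := Fact.out
  set ι : PadicAlgCl 3 ≃+* ℂ := Classical.choice (PadicAlgCl.nonempty_ringEquiv_complex 3) with hι
  obtain ⟨g, hg, hcℓ, haq⟩ := hex ι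
  -- the root `β ≡ q` and `α ≠ β`
  obtain ⟨β, hβ, hβq⟩ :=
    exists_root_valuation_sub_lt_one ι (valuation_cuspCoeff_le_one_of_isNewform0 hg ι q) q haq
  have hαβ : cuspCoeff g q - β ≠ β := by
    by_cases hq31 : q % 3 = 1
    · exact colemanEdixhoven1998_heckePolynomial_simpleRoots.root_ne hCE hg hq hqM (sub_add_cancel _ β)
        (by linear_combination -hβ)
    · exact sub_ne_of_mod_three_ne_one ι hq31 haq hβq
  -- (R2)
  have h1 : M * 1 ∣ M * q := mul_dvd_mul_left M (one_dvd q)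
  have hfC : HasSimpleHeckeGenEigenspace D₀.f := hasSimpleHeckeGenEigenspace_of_isNewform0 D₀.isNewformOf.1
  have hgC : HasSimpleHeckeGenEigenspace
      (iota M (M * q) 1 2 (mul_dvd_mul_left M (one_dvd q)) g - β • iota M (M * q) q 2 dvd_rfl g) :=
    hasSimpleHeckeGenEigenspace_stab_of_ne hg β h1 dvd_rfl hq hqM hβ hαβ
  -- the numeral `r₀ ≡ 1 (mod Mq)` by Chebotarev, and the unit `a_{r₀}(g) − r₀ − 1`
  have hsurj : W₀.HasSurjectiveModNGaloisRep ((3 : ℕ) : ℤ) := by simpa only [pow_one] using htower 1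
  obtain ⟨r₀, hr₀, -, hr₀S, -, hr₀1, hE₀⟩ := exists_prime_one_mod_not_dvd_frobeniusTrace_sub W₀ hsurj (M * q)
  haveI : Fact r₀.Prime := ⟨hr₀⟩
  have hr₀q : r₀ ≠ q := by rintro rfl; exact hr₀S (dvd_mul_left r₀ M)
  have hr₀N : ¬ r₀ ∣ W₀.conductorNorm ℤ := by rwa [← hN]
  have hfr₀ : cuspCoeff D₀.f r₀ = (W₀.frobeniusTrace r₀ : ℂ) := by
    rw [D₀.isNewformOf.2 r₀, LFunction_apply_prime_eq_frobeniusTrace W₀ r₀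
      (hasGoodReductionAtPrime_of_not_dvd_conductorNorm W₀ hr₀N)]
  have hunit : Valued.v (ι.symm (cuspCoeff g r₀ - (r₀ + 1))) = 1 := by
    refine valuation_cuspCoeff_sub_eq_one_of_congr ι hE₀ ?_
    rw [← hfr₀]
    exact hcℓ r₀ hr₀ hr₀q
  -- (R3′)
  have hr₀M : ¬ r₀ ∣ M := fun h ↦ hr₀S (h.mul_right q)
  obtain ⟨Ω, hΩint, γ₀, hγ₀, hΩunit⟩ := exists_period_integral_unit_cycle ι hMsq hg hr₀ hr₀M hunit
  exact stub_nonAdditive_semistable_of_vatsal_of_ihara hV hGV hI hSk hmod hGZK hM hBCDT hLL' W₀ htower hfin hN D₀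
    hopt hdeg hint hord hnA hsst hordinary hv hsplit ι g hg hqM hcℓ haq β hβ hβq hfC hgC Ω hΩint γ₀ hγ₀ hΩunit
    hr₀ hr₀S hr₀1 hunit

end Summit.BirchSwinnertonDyer.BirchSwinnertonDyer.Theorems.KimAtThreeDeepLowerOffStratumLevelLoweringRibetRowsOfExists

end
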